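import Summits.FinalStateConjecture.FinalStateConjecture.Theses.SwallowTheDatum
import Literature.Geometry.Lorentzian.ChainUnionDevelopment
import Literature.Geometry.Lorentzian.MCGHDNoCorrespondingBoundary
import Literature.Geometry.Lorentzian.DataEmbeddingNormalSmooth

/-!
# Route SwallowTheDatum · item `MGHDExists` (stmt-FinalStateConjecture-9937) — the item reduced to
# the three displayed inputs of the printed proofs that the tree does not yet carry

Companion of `Theorems/SwallowTheDatumMGHDExists.lean` (conditional closure of the item from the
named fact `Literature.Geometry.Lorentzian.choquetBruhat_geroch_exists_mghd_cauchy`, and the item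
from the TWO inputs of Choquet-Bruhat–Geroch's printed proof of their Theorem 3: chains bounded,
common extensions). Since that file landed, the tree has absorbed (i) the whole gluing construction
of J. Sbierski, Ann. Henri Poincaré 17 (2016) = arXiv:1309.7591v3, §3.1 and §3.3
(`MaximalCommonDevelopment`, `DevelopmentGluing*`, `MCGHDNoCorrespondingBoundary`,
`DataEmbeddingNormalSmooth`) — so the common-extension input is a theorem GIVEN Sbierski's
Theorem 4 (local existence and uniqueness: any two developments have a common globally hyperbolic
development) and Theorem 12 (a common development with corresponding boundary points is strictly
contained in a larger one) — and (ii) the union of a chain of developments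
(`ChainUnionDevelopment`: Choquet-Bruhat–Geroch 1969, proof of Thm. 3, p. 333) — so the
chains-bounded input is a theorem GIVEN the existence of one development. This file records the
corresponding finer reduction of the ITEM, per admissible datum, so that the ledger displays
exactly what an unconditional proof still owes:

* `mghdExists_of_localExistence_of_localTheory_of_notMCGHD` — `MGHDExists` from THREE displayed
  inputs on admissible data: (1) some vacuum Cauchy development exists (Sbierski Thm. 4, first
  half = Choquet-Bruhat 1952 local existence); (2) any two vacuum Cauchy developments have a
  common globally hyperbolic development (Sbierski Thm. 4, second half = local geometric
  uniqueness); (3) Sbierski Thm. 12 (§3.2: causal theory of globally hyperbolic developments plus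
  a further application of Thm. 4).

All three are quasilinear hyperbolic PDE theory (vacuum Einstein equations in wave gauge) or rest
on it; none has a carrier in Mathlib at the pin. No definition is introduced, nothing is restated,
no named fact is added (the inputs are hypotheses of a theorem, D-0026).
-/

noncomputable section

open scoped Manifold ContDiff
open TopologicalSpace

-- `Summit.FinalStateConjecture.FinalStateConjecture.…`: summit = sub-problem name (D-0017), as in every file here
set_option linter.dupNamespace false

namespace Summit.FinalStateConjecture.FinalStateConjecture.Theorems

open Literature.Geometry.Lorentzian

/-- **Item `MGHDExists` from "local existence", "local theory" (Sbierski 2016, Thm. 4) and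
"NotMCGHD" (Sbierski 2016, Thm. 12), all restricted to admissible data.** For each admissible
datum `D`: the Zorn frame with the chains-bounded input discharged by the union of chains
(`VacuumCauchyDevelopment.exists_isMaximal_of_nonempty_of_common_extension`,
`ChainUnionDevelopment`), fed with the common extension produced by gluing along the maximal
common globally hyperbolic development
(`choquetBruhat_geroch_common_extension_of_localTheory_of_exists_lt`, whose displayed
differentiability hypothesis on unit normals is the theorem
`DataEmbedding.mdifferentiableAt_embed_normal`). -/
theorem mghdExists_of_localExistence_of_localTheory_of_notMCGHD
    (hex : ∀ (X : Type) [TopologicalSpace X] [ChartedSpace E3 X] [IsManifold (𝓡 3) ∞ X]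
      [T2Space X] [SecondCountableTopology X] [ConnectedSpace X] (D : InitialDataSet (𝓡 3) X),
      D ∈ admissibleVacuumData X → Nonempty (VacuumCauchyDevelopment D))
    (hlocal : ∀ (X : Type) [TopologicalSpace X] [ChartedSpace E3 X] [IsManifold (𝓡 3) ∞ X]
      [T2Space X] [SecondCountableTopology X] [ConnectedSpace X] (D : InitialDataSet (𝓡 3) X),
      D ∈ admissibleVacuumData X → ∀ 𝒟 𝒟' : VacuumCauchyDevelopment D,
        ∃ U : Opens 𝒟.carrier, 𝒟.toCauchyDevelopment.IsCommonDevelopment 𝒟'.toDataEmbedding U)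
    (h12 : ∀ (X : Type) [TopologicalSpace X] [ChartedSpace E3 X] [IsManifold (𝓡 3) ∞ X]
      [T2Space X] [SecondCountableTopology X] [ConnectedSpace X] (D : InitialDataSet (𝓡 3) X),
      D ∈ admissibleVacuumData X → ∀ (𝒟 𝒟' : VacuumCauchyDevelopment D)
        (𝔠 : CauchyDevelopment.CommonDevelopment 𝒟.toCauchyDevelopment 𝒟'.toCauchyDevelopment),
        𝔠.HasCorrespondingBoundaryPoints →
          ∃ V : Opens 𝒟.carrier,
            𝒟.toCauchyDevelopment.IsCommonDevelopment 𝒟'.toDataEmbedding V ∧ 𝔠.opens < V) :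
    Summit.FinalStateConjecture.FinalStateConjecture.Theses.SwallowTheDatum.MGHDExists := by
  unfold Theses.SwallowTheDatum.MGHDExists
  intro X _ _ _ _ _ _ D hD
  exact VacuumCauchyDevelopment.exists_isMaximal_of_nonempty_of_common_extension (hex X D hD)
    (choquetBruhat_geroch_common_extension_of_localTheory_of_exists_lt (hlocal X D hD) (h12 X D hD)
      fun 𝒟 x ↦ 𝒟.toDataEmbedding.mdifferentiableAt_embed_normal x)

end Summit.FinalStateConjecture.FinalStateConjecture.Theorems

end
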